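import Summits.AtomisticToContinuum.FouriersLaw.Theorems.EmbeddedDrudeMourreFGRGapEssGapA

/-!
# `FGRGap`, line fold-jet-rigidity, stub `stub_oddEssentialGap` — part B: the kernel lemma

Sequel of `EmbeddedDrudeMourreFGRGapEssGapA` (periodic bookkeeping on windows, unfolding of pairings).
Main result `tendsto_kernel_form_of_weaklyNull`: if `g_n` are `2π`-periodic, measurable, with
`‖g_n‖²_{cell} ≤ 1`, and WEAKLY NULL on the cell (`∫_{cell} φ g_n → 0` for every measurable `φ` with
`‖φ‖²_{cell} < ∞`), then `∫∫ K(x,y) g_n(x) g_n(y) dx dy → 0` for every bounded measurable kernel `K`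
vanishing outside a big square `window × window`: the sections `G_n(x) = ∫ K(x,y) g_n(y) dy` tend to `0`
pointwise (weak nullness against the folded sections), are uniformly bounded and vanish outside the
window, so `‖G_n‖_{L²} → 0` by dominated convergence and `|∫ g_n G_n| ≤ ‖g_n‖ ‖G_n‖ → 0` (Cauchy–Schwarz).
This disposes of the six cross terms of the truncated form in the proof of the odd essential gap.
Folklore; no named facts.
-/

noncomputable section

open MeasureTheory Set Real Filter Topology
open scoped ENNReal
open Literature.MathematicalPhysics.KineticTheory.PhononBoltzmann

namespace Summit.AtomisticToContinuum.FouriersLaw.Theorems.FGRGap.FoldJetRigidity.EssGap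

/-! ## 4. Weakly-null sequences kill bounded compactly supported kernels -/

/-- `|K p| ≤ M` forces `0 ≤ M`. -/
theorem nonneg_of_abs_le {K : ℝ × ℝ → ℝ} {M : ℝ} (hKb : ∀ p, |K p| ≤ M) : 0 ≤ M :=
  (abs_nonneg _).trans (hKb 0)

/-- **Sections of the kernel against a weakly-null sequence tend to zero, with a uniform bound.**
For `K` measurable, `|K| ≤ M`, vanishing off `window × window`, and `g_n` periodic measurable with
`‖g_n‖²_{cell} ≤ 1` and weakly null on the cell: `G_n(x) := ∫ K(x,y) g_n(y) dy → 0` for every `x`,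
`|G_n(x)| ≤ M(2N+1)(π + 1)` always, and `G_n(x) = 0` off the window. [folklore] -/
theorem kernel_section_tendsto {K : ℝ × ℝ → ℝ} (hKm : Measurable K) {M : ℝ} (N : ℕ)
    (hKb : ∀ p, |K p| ≤ M)
    (hK0 : ∀ p, p ∉ Ioc (-π - N * (2 * π)) (π + N * (2 * π)) ×ˢ Ioc (-π - N * (2 * π)) (π + N * (2 * π)) →
      K p = 0)
    {g : ℕ → ℝ → ℝ} (hper : ∀ n, Function.Periodic (g n) (2 * π)) (hgm : ∀ n, Measurable (g n))
    (hg1 : ∀ n, cellNormSq (g n) ≤ 1)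
    (hweak : ∀ φ : ℝ → ℝ, Measurable φ → cellNormSq φ < ∞ →
      Tendsto (fun n => cellPairing φ (g n)) atTop (𝓝 0)) (x : ℝ) :
    Tendsto (fun n => ∫ y, K (x, y) * g n y) atTop (𝓝 0) ∧
      (∀ n, |∫ y, K (x, y) * g n y| ≤ M * (2 * N + 1) * (π + 1)) ∧
      (x ∉ Ioc (-π - N * (2 * π)) (π + N * (2 * π)) → ∀ n, ∫ y, K (x, y) * g n y = 0) := by
  have hM : 0 ≤ M := nonneg_of_abs_le hKb
  have hfin : ∀ n, cellNormSq (g n) < ∞ := fun n => lt_of_le_of_lt (hg1 n) ENNReal.one_lt_top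
  -- the section `y ↦ K (x, y)`
  have hsm : Measurable fun y => K (x, y) := hKm.comp measurable_prodMk_left
  have hs0 : ∀ y, y ∉ Ioc (-π - N * (2 * π)) (π + N * (2 * π)) → K (x, y) = 0 := fun y hy =>
    hK0 (x, y) fun h => hy h.2
  refine ⟨?_, ?_, ?_⟩
  · -- pointwise convergence: unfold the pairing and test weak nullness against the folded section
    have hfold : ∀ n, ∫ y, K (x, y) * g n y =
        cellPairing (fun y => ∑ j ∈ Finset.Icc (-(N : ℤ)) N, K (x, y + j * (2 * π))) (g n) :=
      fun n => integral_mul_eq_cellPairing_fold N hsm (fun y => hKb (x, y)) hs0 (hper n) (hgm n) (hfin n)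
    simp_rw [hfold]
    apply hweak
    · exact Finset.measurable_sum _ fun j _ => hsm.comp (measurable_id.add_const _)
    · -- the folded section is bounded by `(2N+1) M`, hence in `L²(cell)`
      have hb : ∀ y, (∑ j ∈ Finset.Icc (-(N : ℤ)) N, K (x, y + j * (2 * π))) ^ 2 ≤
          ((2 * N + 1) * M) ^ 2 := by
        intro y
        have h1 : |∑ j ∈ Finset.Icc (-(N : ℤ)) N, K (x, y + j * (2 * π))| ≤ (2 * N + 1) * M := by
          calc |∑ j ∈ Finset.Icc (-(N : ℤ)) N, K (x, y + j * (2 * π))|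
              ≤ ∑ j ∈ Finset.Icc (-(N : ℤ)) N, |K (x, y + j * (2 * π))| := Finset.abs_sum_le_sum_abs _ _
            _ ≤ ∑ _j ∈ Finset.Icc (-(N : ℤ)) N, M := Finset.sum_le_sum fun j _ => hKb _
            _ = (2 * N + 1) * M := by
                rw [Finset.sum_const, Int.card_Icc, nsmul_eq_mul]
                have : ((N : ℤ) + 1 - -(N : ℤ)).toNat = 2 * N + 1 := by omega
                rw [this]; push_cast; ring
        have h0 : 0 ≤ (2 * N + 1) * M := by positivity
        nlinarith [abs_nonneg (∑ j ∈ Finset.Icc (-(N : ℤ)) N, K (x, y + j * (2 * π))),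
          sq_abs (∑ j ∈ Finset.Icc (-(N : ℤ)) N, K (x, y + j * (2 * π)))]
      unfold cellNormSq
      calc ∫⁻ y in Ioc (-π) π, ENNReal.ofReal ((∑ j ∈ Finset.Icc (-(N : ℤ)) N, K (x, y + j * (2 * π))) ^ 2)
          ≤ ∫⁻ _ in Ioc (-π) π, ENNReal.ofReal (((2 * N + 1) * M) ^ 2) :=
            lintegral_mono fun y => ENNReal.ofReal_le_ofReal (hb y)
        _ < ∞ := by
            rw [setLIntegral_const]
            exact ENNReal.mul_lt_top ENNReal.ofReal_lt_top
              (by rw [Real.volume_Ioc]; exact ENNReal.ofReal_lt_top)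
  · -- uniform bound
    intro n
    have hgi := integrableOn_window (hper n) (hgm n) (hfin n) N
    have hgi2 := integrableOn_sq_window (hper n) (hgm n) (hfin n) N
    set W : Set ℝ := Ioc (-π - N * (2 * π)) (π + N * (2 * π)) with hW
    have hbound : ∀ y, ‖K (x, y) * g n y‖ ≤ W.indicator (fun y => M * ((1 + g n y ^ 2) / 2)) y := by
      intro y
      by_cases hy : y ∈ W
      · rw [indicator_of_mem hy, norm_mul, Real.norm_eq_abs, Real.norm_eq_abs]
        have h2 : |g n y| ≤ (1 + g n y ^ 2) / 2 := by
          nlinarith [sq_nonneg (|g n y| - 1), sq_abs (g n y), abs_nonneg (g n y)]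
        exact mul_le_mul (hKb _) h2 (abs_nonneg _) hM
      · rw [indicator_of_notMem hy, hs0 y hy, zero_mul, norm_zero]
    have hone : IntegrableOn (fun _ : ℝ => (1 : ℝ)) W volume :=
      integrableOn_const (measure_Ioc_lt_top.ne) (by simp)
    have hbi : Integrable (W.indicator fun y => M * ((1 + g n y ^ 2) / 2)) volume := by
      rw [integrable_indicator_iff measurableSet_Ioc]
      refine Integrable.const_mul ?_ M
      refine Integrable.div_const ?_ 2
      exact hone.integrable.add hgi2.integrable
    have h := norm_integral_le_of_norm_le hbi (Eventually.of_forall hbound)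
    rw [Real.norm_eq_abs] at h
    refine h.trans ?_
    rw [integral_indicator measurableSet_Ioc, integral_const_mul, integral_div,
      integral_add hone.integrable hgi2.integrable]
    have hvol : ∫ _ in W, (1 : ℝ) = (2 * N + 1) * (2 * π) := by
      rw [setIntegral_const, smul_eq_mul, mul_one, measureReal_def, hW, Real.volume_Ioc,
        ENNReal.toReal_ofReal (by nlinarith [Real.pi_pos])]
      ring
    have hsq := integral_sq_window_le (hper n) (hgm n) (hg1 n) N
    rw [hvol]
    rw [← hW] at hsq
    have h3 : (2 * (N : ℝ) + 1) * (2 * π) + ∫ y in W, g n y ^ 2 ≤ (2 * N + 1) * (2 * π) + (2 * N + 1) := by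
      linarith
    calc M * (((2 * (N : ℝ) + 1) * (2 * π) + ∫ y in W, g n y ^ 2) / 2)
        ≤ M * (((2 * N + 1) * (2 * π) + (2 * N + 1)) / 2) := by gcongr
      _ = M * (2 * N + 1) * (π + 1 / 2) := by ring
      _ ≤ M * (2 * N + 1) * (π + 1) := by gcongr; norm_num
  · -- vanishing off the window
    intro hx n
    have : ∀ y, K (x, y) * g n y = 0 := fun y => by
      rw [hK0 (x, y) (fun h => hx h.1), zero_mul]
    simp [this]

/-- **Main lemma A. Weakly-null sequences kill bounded compactly supported kernels**: for `K`
measurable with `|K| ≤ M` vanishing off `window × window`, and `g_n` `2π`-periodic measurable with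
`‖g_n‖²_{cell} ≤ 1` weakly null on the cell, `∫∫ K(x,y) g_n(x) g_n(y) dx dy → 0`. [folklore] -/
theorem tendsto_kernel_form_of_weaklyNull {K : ℝ × ℝ → ℝ} (hKm : Measurable K) {M : ℝ} (N : ℕ)
    (hKb : ∀ p, |K p| ≤ M)
    (hK0 : ∀ p, p ∉ Ioc (-π - N * (2 * π)) (π + N * (2 * π)) ×ˢ Ioc (-π - N * (2 * π)) (π + N * (2 * π)) →
      K p = 0)
    {g : ℕ → ℝ → ℝ} (hper : ∀ n, Function.Periodic (g n) (2 * π)) (hgm : ∀ n, Measurable (g n))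
    (hg1 : ∀ n, cellNormSq (g n) ≤ 1)
    (hweak : ∀ φ : ℝ → ℝ, Measurable φ → cellNormSq φ < ∞ →
      Tendsto (fun n => cellPairing φ (g n)) atTop (𝓝 0)) :
    Tendsto (fun n => ∫ p, K p * (g n p.1 * g n p.2)) atTop (𝓝 0) := by
  have hM : 0 ≤ M := nonneg_of_abs_le hKb
  have hfin : ∀ n, cellNormSq (g n) < ∞ := fun n => lt_of_le_of_lt (hg1 n) ENNReal.one_lt_top
  set W : Set ℝ := Ioc (-π - N * (2 * π)) (π + N * (2 * π)) with hW
  have hWfin : volume W ≠ ∞ := measure_Ioc_lt_top.ne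
  haveI : IsFiniteMeasure (volume.restrict W) := ⟨by rw [Measure.restrict_apply_univ]; exact hWfin.lt_top⟩
  have hgi : ∀ n, IntegrableOn (g n) W := fun n => integrableOn_window (hper n) (hgm n) (hfin n) N
  have hsec := fun x => kernel_section_tendsto hKm N hKb hK0 hper hgm hg1 hweak x
  set C : ℝ := M * (2 * N + 1) * (π + 1) with hC
  -- the section integrals `G n x`
  have hGm : ∀ n, StronglyMeasurable fun x => ∫ y, K (x, y) * g n y := fun n =>
    StronglyMeasurable.integral_prod_right' (f := fun p : ℝ × ℝ => K p * g n p.2)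
      ((hKm.mul ((hgm n).comp measurable_snd)).stronglyMeasurable)
  -- (e) Fubini
  have hF_int : ∀ n, Integrable (fun p : ℝ × ℝ => K p * (g n p.1 * g n p.2)) volume := by
    intro n
    have hind : (fun p : ℝ × ℝ => K p * (g n p.1 * g n p.2)) =
        (W ×ˢ W).indicator (fun p : ℝ × ℝ => K p * (g n p.1 * g n p.2)) := by
      ext p
      by_cases hp : p ∈ W ×ˢ W
      · rw [indicator_of_mem hp]
      · rw [indicator_of_notMem hp, hK0 p hp, zero_mul]
    rw [hind, integrable_indicator_iff (measurableSet_Ioc.prod measurableSet_Ioc), IntegrableOn,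
      Measure.volume_eq_prod, ← Measure.prod_restrict]
    refine Integrable.bdd_mul (c := M) ((hgi n).integrable.mul_prod (hgi n).integrable)
      hKm.aestronglyMeasurable (Eventually.of_forall fun p => ?_)
    rw [Real.norm_eq_abs]; exact hKb p
  have hfub : ∀ n, ∫ p, K p * (g n p.1 * g n p.2) = ∫ x, g n x * ∫ y, K (x, y) * g n y := by
    intro n
    rw [Measure.volume_eq_prod, integral_prod _ (by rw [← Measure.volume_eq_prod]; exact hF_int n)]
    congr 1; ext x
    rw [← integral_const_mul]
    congr 1; ext y; ring
  simp_rw [hfub]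
  -- (f) Cauchy–Schwarz on the window and dominated convergence
  have hzero : ∀ n, ∫ x, g n x * ∫ y, K (x, y) * g n y = ∫ x in W, g n x * ∫ y, K (x, y) * g n y := by
    intro n
    refine (setIntegral_eq_integral_of_forall_compl_eq_zero fun x hx => ?_).symm
    rw [(hsec x).2.2 hx n, mul_zero]
  simp_rw [hzero]
  -- the dominated-convergence statement: `∫_W G_n² → 0`
  have hG2 : Tendsto (fun n => ∫ x in W, (∫ y, K (x, y) * g n y) ^ 2) atTop (𝓝 0) := by
    have h := tendsto_integral_of_dominated_convergence (μ := volume.restrict W)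
      (F := fun n x => (∫ y, K (x, y) * g n y) ^ 2) (f := fun _ => 0) (fun _ => C ^ 2)
      (fun n => ((hGm n).measurable.pow_const 2).aestronglyMeasurable) (integrable_const _)
      (fun n => Eventually.of_forall fun x => by
        rw [Real.norm_eq_abs, abs_pow, sq_abs]
        have hb := (hsec x).2.1 n
        have hC0 : 0 ≤ C := le_trans (abs_nonneg _) hb
        nlinarith [abs_nonneg (∫ y, K (x, y) * g n y), sq_abs (∫ y, K (x, y) * g n y)])
      (Eventually.of_forall fun x => by
        have := ((hsec x).1.pow 2)
        simpa using this)
    simpa using h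
  -- Cauchy–Schwarz
  have hCS : ∀ n, |∫ x in W, g n x * ∫ y, K (x, y) * g n y| ≤
      Real.sqrt (2 * N + 1) * Real.sqrt (∫ x in W, (∫ y, K (x, y) * g n y) ^ 2) := by
    intro n
    have h1 : |∫ x in W, g n x * ∫ y, K (x, y) * g n y| ≤
        ∫ x in W, |g n x| * |∫ y, K (x, y) * g n y| := by
      have := norm_integral_le_integral_norm (μ := volume.restrict W)
        (fun x => g n x * ∫ y, K (x, y) * g n y)
      simpa only [Real.norm_eq_abs, abs_mul] using this
    have hmem1 : MemLp (fun x => |g n x|) (ENNReal.ofReal 2) (volume.restrict W) := by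
      rw [show ENNReal.ofReal 2 = 2 by norm_num]
      exact (memLp_two_window (hper n) (hgm n) (hfin n) N).abs
    have hmem2 : MemLp (fun x => |∫ y, K (x, y) * g n y|) (ENNReal.ofReal 2) (volume.restrict W) := by
      refine MemLp.of_bound ((hGm n).measurable.abs).aestronglyMeasurable C
        (Eventually.of_forall fun x => ?_)
      rw [Real.norm_eq_abs, abs_abs]; exact (hsec x).2.1 n
    have h2 := integral_mul_le_Lp_mul_Lq_of_nonneg (μ := volume.restrict W) Real.HolderConjugate.two_two
      (Eventually.of_forall fun x => abs_nonneg (g n x))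
      (Eventually.of_forall fun x => abs_nonneg (∫ y, K (x, y) * g n y)) hmem1 hmem2
    refine h1.trans (h2.trans ?_)
    have e1 : ∫ x in W, |g n x| ^ (2 : ℝ) = ∫ x in W, g n x ^ 2 := by
      congr 1; ext x; rw [Real.rpow_two, sq_abs]
    have e2 : ∫ x in W, |∫ y, K (x, y) * g n y| ^ (2 : ℝ) = ∫ x in W, (∫ y, K (x, y) * g n y) ^ 2 := by
      congr 1; ext x; rw [Real.rpow_two, sq_abs]
    rw [e1, e2, show (1 : ℝ) / 2 = (1 / 2 : ℝ) from rfl, ← Real.sqrt_eq_rpow, ← Real.sqrt_eq_rpow]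
    gcongr
    exact integral_sq_window_le (hper n) (hgm n) (hg1 n) N
  refine squeeze_zero_norm (a := fun n => Real.sqrt (2 * N + 1) *
      Real.sqrt (∫ x in W, (∫ y, K (x, y) * g n y) ^ 2)) (fun n => ?_) ?_
  · exact (Real.norm_eq_abs _).le.trans (hCS n)
  · have := (hG2.sqrt).const_mul (Real.sqrt (2 * N + 1))
    simpa using this

end Summit.AtomisticToContinuum.FouriersLaw.Theorems.FGRGap.FoldJetRigidity.EssGap

namespace Summit.AtomisticToContinuum.FouriersLaw.Theorems.FGRGap.FoldJetRigidity

/-- REGISTERED HELPER STUB `stub_oddEssentialGap_partB` (landing vehicle of this file): weakly-null periodic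
unit sequences kill bounded kernels supported in a big square (`EssGap.tendsto_kernel_form_of_weaklyNull`).
[folklore] -/
theorem stub_oddEssentialGap_partB :
    ∀ (K : ℝ × ℝ → ℝ) (M : ℝ) (N : ℕ) (g : ℕ → ℝ → ℝ), Measurable K → (∀ p, |K p| ≤ M) →
      (∀ p, p ∉ Set.Ioc (-π - N * (2 * π)) (π + N * (2 * π)) ×ˢ Set.Ioc (-π - N * (2 * π)) (π + N * (2 * π)) →
        K p = 0) →
      (∀ n, Function.Periodic (g n) (2 * π)) → (∀ n, Measurable (g n)) → (∀ n, cellNormSq (g n) ≤ 1) →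
      (∀ φ : ℝ → ℝ, Measurable φ → cellNormSq φ < ⊤ →
        Filter.Tendsto (fun n => cellPairing φ (g n)) Filter.atTop (nhds 0)) →
      Filter.Tendsto (fun n => ∫ p, K p * (g n p.1 * g n p.2)) Filter.atTop (nhds 0) :=
  fun _K _M N _g hKm hKb hK0 hper hgm hg1 hweak =>
    EssGap.tendsto_kernel_form_of_weaklyNull hKm N hKb hK0 hper hgm hg1 hweak

end Summit.AtomisticToContinuum.FouriersLaw.Theorems.FGRGap.FoldJetRigidity

end
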